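import Literature.MathematicalPhysics.QuantumLattice.InfVolFermionStateCompactness
import Literature.MathematicalPhysics.QuantumLattice.FinDimSpectrumProofs
import HarnessLib

/-!
# The thermodynamic limit of the ground-state energy density of a periodised local Hamiltonian on
# fermionic tori EXISTS and is the least mean energy of a translation-invariant state

Topic `Literature/MathematicalPhysics/QuantumLattice` (family `hubbard`); companion of
`InfVolFermionState.lean` (torus limits `IsTorusLimitOf`, translation averages `torusAvgExpectAt`)
and `InfVolFermionStateCompactness.lean` (weak-⋆ compactness `exists_isTorusLimitOf_subseq`).
Written for the pinning-field programme of the Hubbard cell `hubbard-cq` (LADDER row PC-a: the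
pair-sourced, grand-canonical Hubbard torus `dWaveSourceTorus L U μ h = H − μN − h(Δ_d + Δ_d†)`
minimised over the WHOLE Fock space), whose transport / Hellmann–Feynman nodes
(`Summit.Ventures.CertifiedManyBodySolver.Observables.SourcedOrderParameterFloor`, §3) take the
convergence of `E₀(A_L)/L²` as a hypothesis; the canonical (`N`-conserving, fixed density) models of
the tree get their limit from Fekete-type tiling arguments instead (`SquareTilingLimit`,
`HubbardNNNHoppingThermodynamicLimit`), which are not available once the source breaks particle-number
conservation. Everything here is PROVED and MODEL-FREE; no definition, no named fact.

## Setting and results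

Fix a finite window `Λ' ⊆ ℤ^d` and a local observable `E ∈ 𝔄_{Λ'}` (the "energy density at the
origin"). On the fermionic torus of side `L` (large enough for `x ↦ x mod L` to be injective on `Λ'`)
the PERIODISED HAMILTONIAN is `H_L = Σ_{v ∈ (ℤ/Lℤ)^d} T_v Γ(E) T_v⁻¹` (`Γ = fermionEmbed (toTorusEmb L)`,
`T_v = relabel (Orb.translate v)`); the theorems take any family `H L` together with this identity
as a hypothesis (`hH`), which is how the tree presents its torus Hamiltonians
(`sum_relabel_translate_hubbardTTPrime_meanEnergyObs`, `sum_conj_fockTranslate_pairSourceObjective`).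
`E₀ = Matrix.groundEnergy` (minimum over the whole Fock space).

* §1 `groundEnergy_le_re_of_state` — `E₀(A) ≤ Re φ(A)` for every STATE `φ` (unital,
  `φ(X⋆X) ≥ 0`) of the matrix algebra (`A − E₀ = B⋆B`).
* §2 `torusAvgExpectAt_eq_expect_div_of_sum_relabel` — the translation-averaged expectation of `E`
  in a torus vector `ψ` is `⟨ψ, H_L ψ⟩ / L^d`; hence (`groundEnergy_div_le_re_torusAvgExpectAt`)
  `E₀(H_L)/L^d ≤ Re (torus average of E)` for unit `ψ`, with equality on ground-state vectors.
* §3 `groundEnergy_le_card_mul_re_expect_add` — the BOX-STATE UPPER BOUND: for every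
  translation-invariant infinite-volume state `ω`,
  `E₀(H_L) ≤ L^d · Re ω(E) + (L^d − (L − 2R)^d) · C_E`, `Λ' ⊆ [−R, R]^d`,
  `C_E = −E₀(−E) − E₀(E) ≥ 0`: restrict `ω` to the box `[0, L)^d ≅ (ℤ/Lℤ)^d`, a state of the WHOLE
  torus algebra (Bratteli–Robinson II §6.2.2: periodic boxes); interior translates of `E` have
  expectation `ω(E)` by translation invariance, the `O(L^{d−1})` wrapped ones are bounded by
  positivity.
* §4 `exists_tendsto_groundEnergy_div_pow` — THE LIMIT: `E₀(H_L)/L^d → e_∞` where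
  `e_∞ ≤ Re ω(E)` for every translation-invariant `ω` and `e_∞ = Re ω⋆(E)` for some
  translation-invariant `ω⋆` (a torus limit of ground-state vectors): `e_∞ = min_ω Re ω(E)`,
  Bratteli–Kishimoto–Robinson's mean-energy minimum (1978, Thm. 2) realised with periodic boundary
  conditions. Lower half: weak-⋆ compactness of the averaged ground states along any subsequence
  (`exists_isTorusLimitOf_subseq`) and §2; upper half: §3.
  `IsTorusLimitOf.re_expect_eq_lim_of_groundStates` — every torus limit of unit ground-state
  vectors attains `e_∞`; `re_expect_ge_lim_of_isTranslationInvariant` — the variational principle.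

## References
* O. Bratteli, D. W. Robinson, *Operator Algebras and Quantum Statistical Mechanics 2*, 2nd ed.
  (1997), §6.2.2 (thermodynamic limit with periodic boundary conditions), Thm. 6.2.58.
  [cite: BratteliRobinsonII1997, §6.2.2]
* O. Bratteli, A. Kishimoto, D. W. Robinson, CMP 64 (1978) 41, Thm. 2 (translation-invariant ground
  states minimise the mean energy). [cite: BratteliKishimotoRobinson1978, Thm. 2]
* D. Ruelle, *Statistical Mechanics: Rigorous Results* (1969), §3.3–§3.4 (ground-state energy density
  as a limit and as a variational minimum). [cite: Ruelle1969, §3.3]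
* T. Koma, H. Tasaki, J. Stat. Phys. 76 (1994) 745, §1 (ground states of `H_Λ − hO_Λ` on periodic
  boxes; the volume limit taken first). [cite: KomaTasaki1994, §1]
-/

noncomputable section

namespace Literature.MathematicalPhysics.QuantumLattice

open Matrix Finset HubbardWave0 Literature.Probability.LatticeModels _root_.Filter
open scoped _root_.Topology ComplexOrder BigOperators MatrixOrder InnerProductSpace

/-! ### §1 States of a matrix algebra see at least the ground energy

(Declared directly in `Literature.MathematicalPhysics.QuantumLattice`, NOT as `Matrix.…`: a nested
namespace `….QuantumLattice.Matrix` would shadow Mathlib's `Matrix` for `open Matrix` in every importer.) -/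

/-- **`E₀(A) ≤ Re φ(A)` for every state `φ`** (unital, positive on `X⋆X`) of the matrix algebra and
every Hermitian `A`: `A − E₀ = B⋆B` — the variational principle for mixed states.
[cite: Tasaki2020, §2.1] -/
theorem groundEnergy_le_re_of_state {n : Type*} [Fintype n] [DecidableEq n]
    {A : Matrix n n ℂ} (hA : A.IsHermitian) (φ : Matrix n n ℂ →ₗ[ℂ] ℂ) (h1 : φ 1 = 1)
    (hpos : ∀ X : Matrix n n ℂ, 0 ≤ φ (Xᴴ * X)) : A.groundEnergy ≤ (φ A).re := by
  obtain ⟨B, hB⟩ := (CStarAlgebra.nonneg_iff_eq_star_mul_self (A := Matrix n n ℂ)).mp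
    (posSemidef_sub_groundEnergy hA).nonneg
  have h := hpos B
  rw [← Matrix.star_eq_conjTranspose, ← hB, map_sub, Algebra.algebraMap_eq_smul_one, LinearMap.map_smul_of_tower, h1] at h
  obtain ⟨hre, -⟩ := Complex.nonneg_iff.mp h
  simp only [Complex.sub_re, Complex.real_smul, mul_one, Complex.ofReal_re] at hre
  linarith

/-- The restriction `ω_Λ` of an infinite-volume state sees at least the ground energy of every
Hermitian local observable: `E₀(A) ≤ Re ω_Λ(A)` (variational principle for the density matrix of `ω_Λ`).
[cite: Tasaki2020, §2.1] -/
theorem InfVolFermionState.groundEnergy_le_re_expect {d : ℕ} (ω : InfVolFermionState d)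
    (Λ : Finset (Site d)) {A : FermionOp Λ} (hA : A.IsHermitian) :
    A.groundEnergy ≤ (ω.expect Λ A).re :=
  groundEnergy_le_re_of_state hA (ω.expect Λ) (ω.expect_one Λ) (ω.expect_nonneg Λ)

/-- Upper companion: `Re ω_Λ(A) ≤ −E₀(−A)` (variational principle applied to `−A`). [cite: Tasaki2020, §2.1] -/
theorem InfVolFermionState.re_expect_le_neg_groundEnergy_neg {d : ℕ} (ω : InfVolFermionState d)
    (Λ : Finset (Site d)) {A : FermionOp Λ} (hA : A.IsHermitian) :
    (ω.expect Λ A).re ≤ -(-A).groundEnergy := by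
  have h := ω.groundEnergy_le_re_expect Λ hA.neg
  rw [map_neg, Complex.neg_re] at h
  linarith

variable {d : ℕ}

/-! ### §2 The periodised Hamiltonian: averaged expectation of `E` = energy per site -/

section Periodised

variable {Λ' : Finset (Site d)} (E : FermionOp Λ') (L : ℕ) [NeZero L]
  (hInj : Set.InjOn (Torus.proj (d := d) L) ↑Λ')

/-- `|(ℤ/Lℤ)^d| = L^d`. [folklore] -/
private theorem card_torusSite_eq_pow : Fintype.card (TorusSite d L) = L ^ d := by
  simp [ZMod.card, Fintype.card_fin]

/-- **The periodised Hamiltonian is Hermitian** when `E` is (a sum of translates of a self-adjoint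
local term). [cite: BratteliRobinsonII1997, §6.2.2] -/
theorem isHermitian_sum_relabel_translate (hE : E.IsHermitian) :
    (∑ v : TorusSite d L, relabel (Orb.translate v) (fermionEmbed (PolySite.toTorusEmb L hInj) E)).IsHermitian := by
  rw [Matrix.IsHermitian, Matrix.conjTranspose_sum]
  refine Finset.sum_congr rfl fun v _ => ?_
  rw [← relabel_conjTranspose, ← fermionEmbed_conjTranspose, hE.eq]

/-- **The translation average of `E` is the energy per site**: if `Σ_v T_v Γ(E) T_v⁻¹ = H`, then for
every torus vector `ψ`, `torusAvgExpectAt L Λ' E ψ = ⟨ψ, Hψ⟩ / L^d`.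
[cite: BratteliRobinsonII1997, §6.2.2] -/
theorem torusAvgExpectAt_eq_expect_div_of_sum_relabel
    {H : Matrix (Finset (Orb (FermionTorus d L))) (Finset (Orb (FermionTorus d L))) ℂ}
    (hH : ∑ v : TorusSite d L, relabel (Orb.translate v) (fermionEmbed (PolySite.toTorusEmb L hInj) E) = H)
    (ψ : Fock (Orb (FermionTorus d L))) :
    torusAvgExpectAt L Λ' E ψ = expect H ψ / ((L : ℂ) ^ d) := by
  rw [torusAvgExpectAt_of_injOn L hInj, card_torusSite_eq_pow, Nat.cast_pow, div_eq_inv_mul]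
  congr 1
  set B := fermionEmbed (PolySite.toTorusEmb L hInj) E with hB
  have hstep : ∀ v : TorusSite d L,
      expect B ((fockTranslate v).val *ᵥ ψ) = expect (relabel (Orb.translate (-v)) B) ψ := by
    intro v
    rw [expect_fockRelabel_mulVec, ← Equiv.Perm.inv_def, ← Orb.translate_neg]
  simp_rw [hstep]
  rw [Fintype.sum_equiv (Equiv.neg (TorusSite d L))
      (fun v => expect (relabel (Orb.translate (-v)) B) ψ)
      (fun v => expect (relabel (Orb.translate v) B) ψ) (fun v => rfl)]
  have hsum : ∀ (s : Finset (TorusSite d L))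
      (f : TorusSite d L → Matrix (Finset (Orb (FermionTorus d L))) (Finset (Orb (FermionTorus d L))) ℂ),
      ∑ v ∈ s, expect (f v) ψ = expect (∑ v ∈ s, f v) ψ := by
    intro s f
    rw [expect, Matrix.sum_mulVec, dotProduct_sum]
    rfl
  rw [hsum, hH]

/-- **Variational half, finite volume**: for a unit torus vector `ψ`,
`E₀(H) / L^d ≤ Re (torusAvgExpectAt L Λ' E ψ)`. [cite: Tasaki2020, §2.1] -/
theorem groundEnergy_div_le_re_torusAvgExpectAt (hE : E.IsHermitian)
    {H : Matrix (Finset (Orb (FermionTorus d L))) (Finset (Orb (FermionTorus d L))) ℂ}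
    (hH : ∑ v : TorusSite d L, relabel (Orb.translate v) (fermionEmbed (PolySite.toTorusEmb L hInj) E) = H)
    {ψ : Fock (Orb (FermionTorus d L))} (h1 : star ψ ⬝ᵥ ψ = 1) :
    H.groundEnergy / ((L : ℝ) ^ d) ≤ (torusAvgExpectAt L Λ' E ψ).re := by
  have hHerm : H.IsHermitian := by rw [← hH]; exact isHermitian_sum_relabel_translate E L hInj hE
  have hray := Matrix.groundEnergy_le_rayleigh_holds hHerm ψ h1
  rw [torusAvgExpectAt_eq_expect_div_of_sum_relabel E L hInj hH, ← Complex.ofReal_natCast,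
    ← Complex.ofReal_pow, Complex.div_ofReal_re, expect]
  have hL : (0 : ℝ) < (L : ℝ) ^ d := pow_pos (Nat.cast_pos.2 (NeZero.pos L)) d
  exact div_le_div_of_nonneg_right hray hL.le

/-- **On a unit ground-state vector the average is exactly the energy per site**:
`Re (torusAvgExpectAt L Λ' E ψ) = E₀(H) / L^d` if `Hψ = E₀ψ`, `‖ψ‖ = 1`. [cite: Tasaki2020, §2.1] -/
theorem re_torusAvgExpectAt_eq_groundEnergy_div
    {H : Matrix (Finset (Orb (FermionTorus d L))) (Finset (Orb (FermionTorus d L))) ℂ}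
    (hH : ∑ v : TorusSite d L, relabel (Orb.translate v) (fermionEmbed (PolySite.toTorusEmb L hInj) E) = H)
    {ψ : Fock (Orb (FermionTorus d L))} (h1 : star ψ ⬝ᵥ ψ = 1)
    (hψ : H *ᵥ ψ = (H.groundEnergy : ℂ) • ψ) :
    (torusAvgExpectAt L Λ' E ψ).re = H.groundEnergy / ((L : ℝ) ^ d) := by
  rw [torusAvgExpectAt_eq_expect_div_of_sum_relabel E L hInj hH, ← Complex.ofReal_natCast,
    ← Complex.ofReal_pow, Complex.div_ofReal_re, expect, hψ, dotProduct_smul, h1, smul_eq_mul, mul_one,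
    Complex.ofReal_re]

end Periodised

/-! ### §3 The box state: every translation-invariant state bounds the torus ground energy above -/

/-- `relabel e 1 = 1` (rewriting form). [folklore] -/
private theorem relabel_one' {ι ι' : Type*} [LinearOrder ι] [Fintype ι] [LinearOrder ι'] [Fintype ι']
    (e : ι ≃ ι') : relabel e (1 : Matrix (Finset ι) (Finset ι) ℂ) = 1 :=
  map_one (relabel e)

/-- Counting the interior: for `Λ' ⊆ [−R, R]^d` and `2R ≤ L`, at least `(L − 2R)^d` translates
`v ∈ [0, L)^d` have `Λ' + v ⊆ [0, L)^d`. [folklore] -/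
private theorem pow_le_card_filter_shiftSet_subset {L : ℕ} {Λ' : Finset (Site d)} {R : ℕ}
    (hR : ∀ x ∈ Λ', ∀ i, |x i| ≤ R) (h2R : 2 * R ≤ L) :
    (L - 2 * R) ^ d ≤ ((halfOpenBox d L).filter fun v => shiftSet v Λ' ⊆ halfOpenBox d L).card := by
  classical
  set r : Site d := fun _ => (R : ℤ) with hr
  have hinj : Set.InjOn (fun u : Site d => u + r) ↑(halfOpenBox d (L - 2 * R)) :=
    fun a _ b _ hab => add_right_cancel hab
  rw [← card_halfOpenBox d (L - 2 * R), ← Finset.card_image_of_injOn hinj]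
  refine Finset.card_le_card fun v hv => ?_
  rw [Finset.mem_image] at hv
  obtain ⟨u, hu, rfl⟩ := hv
  rw [mem_halfOpenBox] at hu
  have hcast : ((L - 2 * R : ℕ) : ℤ) = (L : ℤ) - 2 * R := by
    rw [Nat.cast_sub h2R]; push_cast; ring
  rw [Finset.mem_filter, mem_halfOpenBox]
  refine ⟨fun i => ?_, fun y hy => ?_⟩
  · have h := hu i
    rw [hcast] at h
    simp only [Pi.add_apply, hr]
    constructor <;> linarith [h.1, h.2]
  · rw [mem_shiftSet] at hy
    have hx := hR _ hy
    rw [mem_halfOpenBox]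
    intro i
    have h1 := hx i
    have h2 := hu i
    rw [hcast] at h2
    rw [abs_le] at h1
    simp only [Pi.sub_apply, Pi.add_apply, hr] at h1
    constructor <;> linarith [h1.1, h1.2, h2.1, h2.2]

/-- Every finite window lies in some cube `[−R, R]^d`. [folklore] -/
private theorem exists_forall_abs_apply_le (Λ' : Finset (Site d)) : ∃ R : ℕ, ∀ x ∈ Λ', ∀ i, |x i| ≤ R := by
  classical
  refine ⟨Λ'.sup fun x => Finset.univ.sup fun i => (x i).natAbs, fun x hx i => ?_⟩
  have h1 : (x i).natAbs ≤ Finset.univ.sup fun i => (x i).natAbs :=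
    Finset.le_sup (f := fun i => (x i).natAbs) (Finset.mem_univ i)
  have h2 : (Finset.univ.sup fun i => (x i).natAbs) ≤ Λ'.sup fun x => Finset.univ.sup fun i => (x i).natAbs :=
    Finset.le_sup (f := fun x => Finset.univ.sup fun i => (x i).natAbs) hx
  have h3 : ((x i).natAbs : ℤ) ≤ ((Λ'.sup fun x => Finset.univ.sup fun i => (x i).natAbs : ℕ) : ℤ) := by
    exact_mod_cast h1.trans h2
  rw [← Int.natCast_natAbs]
  exact h3

section BoxState

variable (L : ℕ) [NeZero L]

/-- `x ↦ x mod L` is injective on the box `[0, L)^d`. [cite: FriedliVelenik2017, §3.1] -/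
theorem injOn_proj_halfOpenBox : Set.InjOn (Torus.proj (d := d) L) ↑(halfOpenBox d L) :=
  (torusProj_bijOn_halfOpenBox (d := d) L).injOn

/-- The box `[0, L)^d` is a fundamental domain: `x ↦ x mod L` is a bijection of its ordered sites onto
the orbital sites of the torus. [cite: FriedliVelenik2017, §3.1] -/
theorem bijective_toTorusEmb_halfOpenBox :
    Function.Bijective (PolySite.toTorusEmb L (injOn_proj_halfOpenBox (d := d) L)) := by
  refine ⟨(PolySite.toTorusEmb L _).injective, fun f => ?_⟩
  obtain ⟨y, hy, hyx⟩ := (torusProj_bijOn_halfOpenBox (d := d) L).surjOn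
    (Set.mem_univ (FermionTorus.toTorusSite f))
  refine ⟨PolySite.pt y hy, ?_⟩
  rw [PolySite.toTorusEmb_apply]
  change FermionTorus.ofTorusSite (Torus.proj L y) = f
  rw [hyx, FermionTorus.ofTorusSite_toTorusSite]

/-- **Pull-back to the full torus is the relabelling along the box bijection** (so it is an algebra
ISOMORPHISM `𝔄_{[0,L)^d} ≅ End(Fock torus)`). [cite: BratteliRobinsonII1997, §5.2.2, Thm. 5.2.5] -/
theorem fermionEmbed_toTorusEmb_halfOpenBox_eq_relabel (A : FermionOp (halfOpenBox d L)) :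
    fermionEmbed (PolySite.toTorusEmb L (injOn_proj_halfOpenBox (d := d) L)) A =
      relabel (Orb.mapEquiv (Equiv.ofBijective _ (bijective_toTorusEmb_halfOpenBox (d := d) L))) A := by
  have h := fermionEmbed_equiv (Equiv.ofBijective _ (bijective_toTorusEmb_halfOpenBox (d := d) L))
  rw [fermionEmbed_congr (φ := PolySite.toTorusEmb L (injOn_proj_halfOpenBox (d := d) L))
    (ψ := (Equiv.ofBijective _ (bijective_toTorusEmb_halfOpenBox (d := d) L)).toEmbedding) (fun x => rfl), h]
  rfl

variable {L} in
/-- Interior translates: for `v` with `Λ' + v ⊆ [0, L)^d`, the torus translate `T_{v mod L} Γ_{Λ'}(E)`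
is the pull-back from the box of the translated observable `Γ(incl) Γ(τ_v) E`. [folklore] -/
private theorem relabel_translate_fermionEmbed_eq_of_shiftSet_subset {Λ' : Finset (Site d)}
    (hInj : Set.InjOn (Torus.proj (d := d) L) ↑Λ') (E : FermionOp Λ') {v : Site d}
    (hv : shiftSet v Λ' ⊆ halfOpenBox d L) :
    relabel (Orb.translate (Torus.proj L v)) (fermionEmbed (PolySite.toTorusEmb L hInj) E) =
      fermionEmbed (PolySite.toTorusEmb L (injOn_proj_halfOpenBox (d := d) L))
        (fermionEmbed (PolySite.incl hv) (fermionEmbed (PolySite.shiftEmb v Λ') E)) := by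
  have h' : Set.InjOn (Torus.proj (d := d) L) ↑(shiftSet v Λ') :=
    (injOn_proj_halfOpenBox (d := d) L).mono (by exact_mod_cast hv)
  rw [← fermionEmbed_toTorusEmb_shiftEmb L v hInj h' E, fermionEmbed_fermionEmbed (PolySite.incl hv)]
  exact congrFun (congrArg DFunLike.coe (fermionEmbed_congr fun p => rfl)) _

/-- **Positivity bound for one translate**: for a state `φ` of the torus algebra and Hermitian `E`,
`Re φ(T_v Γ(E) T_v⁻¹) ≤ −E₀(−E)` (`−E₀(−E) − E = C⋆C` is pushed through the `*`-homomorphisms).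
[folklore] -/
private theorem re_state_relabel_fermionEmbed_le {Λ' : Finset (Site d)}
    (hInj : Set.InjOn (Torus.proj (d := d) L) ↑Λ') {E : FermionOp Λ'} (hE : E.IsHermitian)
    (φ : Matrix (Finset (Orb (FermionTorus d L))) (Finset (Orb (FermionTorus d L))) ℂ →ₗ[ℂ] ℂ)
    (h1 : φ 1 = 1) (hpos : ∀ X, 0 ≤ φ (Xᴴ * X)) (v : TorusSite d L) :
    (φ (relabel (Orb.translate v) (fermionEmbed (PolySite.toTorusEmb L hInj) E))).re ≤
      -(-E).groundEnergy := by
  -- `c − E = C⋆C`, `c = −E₀(−E)`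
  have hpsd : ((((-(-E).groundEnergy : ℝ)) : ℂ) • (1 : FermionOp Λ') - E).PosSemidef := by
    have h := posSemidef_sub_groundEnergy hE.neg
    rw [Algebra.algebraMap_eq_smul_one, ← Complex.coe_smul] at h
    have heq : (((-(-E).groundEnergy : ℝ)) : ℂ) • (1 : FermionOp Λ') - E =
        -E - (((-E).groundEnergy : ℝ) : ℂ) • (1 : FermionOp Λ') := by
      rw [Complex.ofReal_neg, neg_smul]; abel
    rw [heq]; exact h
  obtain ⟨C, hC⟩ := (CStarAlgebra.nonneg_iff_eq_star_mul_self (A := FermionOp Λ')).mp hpsd.nonneg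
  rw [Matrix.star_eq_conjTranspose] at hC
  have hY : relabel (Orb.translate v) (fermionEmbed (PolySite.toTorusEmb L hInj)
        ((((-(-E).groundEnergy : ℝ)) : ℂ) • (1 : FermionOp Λ') - E)) =
      (relabel (Orb.translate v) (fermionEmbed (PolySite.toTorusEmb L hInj) C))ᴴ *
        relabel (Orb.translate v) (fermionEmbed (PolySite.toTorusEmb L hInj) C) := by
    rw [hC, fermionEmbed_mul, fermionEmbed_conjTranspose, relabel_mul, relabel_conjTranspose]
  have hpos' := hpos (relabel (Orb.translate v) (fermionEmbed (PolySite.toTorusEmb L hInj) C))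
  -- the unit, through the two homomorphisms (the `DecidableEq` instances carried by the generic
  -- lemmas differ from the ambient ones only propositionally)
  have hone : relabel (Orb.translate v) (fermionEmbed (PolySite.toTorusEmb L hInj) (1 : FermionOp Λ')) =
      (1 : Matrix (Finset (Orb (FermionTorus d L))) (Finset (Orb (FermionTorus d L))) ℂ) := by
    rw [fermionEmbed_one, relabel_one']
    ext a b
    simp only [Matrix.one_apply]
    by_cases h : a = b
    · rw [if_pos h, if_pos h]
    · rw [if_neg h, if_neg h]
  rw [← hY, fermionEmbed_sub, fermionEmbed_smul, relabel_sub, relabel_smul, hone,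
    map_sub, LinearMap.map_smul, h1] at hpos'
  obtain ⟨hre, -⟩ := Complex.nonneg_iff.mp hpos'
  simp only [Complex.sub_re, smul_eq_mul, mul_one, Complex.ofReal_re] at hre
  linarith

variable {L} in
/-- **The box-state upper bound.** For a translation-invariant infinite-volume state `ω`, a Hermitian
`E ∈ 𝔄_{Λ'}` with `Λ' ⊆ [−R, R]^d`, `2R ≤ L`, and `H = Σ_v T_v Γ(E) T_v⁻¹` on the torus of side `L`:
`E₀(H) ≤ L^d · Re ω(E) + (L^d − (L − 2R)^d) · (−E₀(−E) − E₀(E))`. The state of the torus algebra is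
`ω` restricted to the box `[0,L)^d` (an algebra isomorphism onto the torus algebra); the `≥ (L−2R)^d`
interior translates of `E` have expectation `ω(E)` by translation invariance, every translate has
expectation `≤ −E₀(−E)` by positivity, and `E₀(E) ≤ Re ω(E)`.
[cite: BratteliRobinsonII1997, §6.2.2] -/
theorem groundEnergy_le_pow_mul_re_expect_add {Λ' : Finset (Site d)}
    (hInj : Set.InjOn (Torus.proj (d := d) L) ↑Λ') {E : FermionOp Λ'} (hE : E.IsHermitian)
    {R : ℕ} (hR : ∀ x ∈ Λ', ∀ i, |x i| ≤ R) (h2R : 2 * R ≤ L)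
    {H : Matrix (Finset (Orb (FermionTorus d L))) (Finset (Orb (FermionTorus d L))) ℂ}
    (hH : ∑ v : TorusSite d L, relabel (Orb.translate v) (fermionEmbed (PolySite.toTorusEmb L hInj) E) = H)
    (ω : InfVolFermionState d) (hω : ω.IsTranslationInvariant) :
    H.groundEnergy ≤ (L : ℝ) ^ d * (ω.expect Λ' E).re +
      ((L : ℝ) ^ d - ((L - 2 * R : ℕ) : ℝ) ^ d) * (-(-E).groundEnergy - E.groundEnergy) := by
  classical
  -- the box state of the torus algebra
  set eO := Orb.mapEquiv (Equiv.ofBijective _ (bijective_toTorusEmb_halfOpenBox (d := d) L)) with heO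
  -- (built by hand: composing with `(relabel _).toLinearMap` would make Lean compare the generic and
  -- the ambient instance paths of the matrix algebra)
  set φ : Matrix (Finset (Orb (FermionTorus d L))) (Finset (Orb (FermionTorus d L))) ℂ →ₗ[ℂ] ℂ :=
    { toFun := fun X => ω.expect (halfOpenBox d L) (relabel eO.symm X)
      map_add' := fun X Y => by rw [relabel_add]; exact (ω.expect _).map_add _ _
      map_smul' := fun a X => by rw [relabel_smul]; exact (ω.expect _).map_smul a _ } with hφ
  have hφapp : ∀ X, φ X = ω.expect (halfOpenBox d L) (relabel eO.symm X) := fun X => rfl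
  have h1 : φ 1 = 1 := by
    rw [hφapp]
    -- `relabel eO.symm 1 = 1`; the unit of the torus algebra produced by the generic lemma carries the
    -- order-derived `DecidableEq` instance, equal to the ambient one only propositionally
    have hg := relabel_one' eO
    have e1 : (1 : Matrix (Finset (Orb (FermionTorus d L))) (Finset (Orb (FermionTorus d L))) ℂ) =
        relabel eO (1 : FermionOp (halfOpenBox d L)) := by
      rw [hg]
      ext a b
      simp only [Matrix.one_apply]
      by_cases h : a = b
      · rw [if_pos h, if_pos h]
      · rw [if_neg h, if_neg h]
    rw [e1, relabel_symm_relabel, ω.expect_one]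
  have hpos : ∀ X, 0 ≤ φ (Xᴴ * X) := by
    intro X
    rw [hφapp, relabel_mul, relabel_conjTranspose]
    exact ω.expect_nonneg _ _
  -- `E₀(H) ≤ Re φ(H)`
  have hHerm : H.IsHermitian := by rw [← hH]; exact isHermitian_sum_relabel_translate E L hInj hE
  refine (groundEnergy_le_re_of_state hHerm φ h1 hpos).trans ?_
  -- termwise
  set c : ℝ := -(-E).groundEnergy with hc
  set e : ℝ := (ω.expect Λ' E).re with he
  set T : Site d → ℝ := fun v =>
    (φ (relabel (Orb.translate (Torus.proj L v)) (fermionEmbed (PolySite.toTorusEmb L hInj) E))).re with hT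
  have hTle : ∀ v, T v ≤ c := fun v =>
    re_state_relabel_fermionEmbed_le L hInj hE φ h1 hpos (Torus.proj L v)
  have hTint : ∀ v, shiftSet v Λ' ⊆ halfOpenBox d L → T v = e := by
    intro v hv
    simp only [hT]
    rw [hφapp, relabel_translate_fermionEmbed_eq_of_shiftSet_subset hInj E hv,
      fermionEmbed_toTorusEmb_halfOpenBox_eq_relabel, ← heO, relabel_symm_relabel,
      ω.compatible hv, ← InfVolFermionState.shift_expect, hω v]
  have hec : e ≤ c := ω.re_expect_le_neg_groundEnergy_neg Λ' hE
  have hE0e : E.groundEnergy ≤ e := ω.groundEnergy_le_re_expect Λ' hE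
  -- `Re φ(H) = Σ_{v ∈ box} T v`
  have hsum : (φ H).re = ∑ v ∈ halfOpenBox d L, T v := by
    rw [← hH, map_sum, Complex.re_sum]
    have himage : (Finset.univ : Finset (TorusSite d L)) = (halfOpenBox d L).image (Torus.proj L) := by
      refine (Finset.eq_univ_iff_forall.2 fun x => ?_).symm
      obtain ⟨y, hy, hyx⟩ := (torusProj_bijOn_halfOpenBox (d := d) L).surjOn (Set.mem_univ x)
      exact Finset.mem_image.2 ⟨y, hy, hyx⟩
    rw [himage, Finset.sum_image (fun a ha b hb hab => injOn_proj_halfOpenBox (d := d) L ha hb hab)]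
  rw [hsum, ← Finset.sum_filter_add_sum_filter_not (halfOpenBox d L)
    (fun v => shiftSet v Λ' ⊆ halfOpenBox d L)]
  set I := (halfOpenBox d L).filter fun v => shiftSet v Λ' ⊆ halfOpenBox d L with hI
  set J := (halfOpenBox d L).filter fun v => ¬ shiftSet v Λ' ⊆ halfOpenBox d L with hJ
  have hIsum : ∑ v ∈ I, T v = (I.card : ℝ) * e := by
    rw [Finset.sum_congr rfl fun v hv => hTint v (Finset.mem_filter.1 hv).2, Finset.sum_const,
      nsmul_eq_mul]
  have hJsum : ∑ v ∈ J, T v ≤ (J.card : ℝ) * c := by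
    have := Finset.sum_le_sum fun v (_ : v ∈ J) => hTle v
    rwa [Finset.sum_const, nsmul_eq_mul] at this
  have hcardIJ : (I.card : ℝ) + J.card = (L : ℝ) ^ d := by
    have h := Finset.card_filter_add_card_filter_not (s := halfOpenBox d L)
      (p := fun v => shiftSet v Λ' ⊆ halfOpenBox d L)
    rw [card_halfOpenBox] at h
    exact_mod_cast h
  have hIge : ((L - 2 * R : ℕ) : ℝ) ^ d ≤ (I.card : ℝ) := by
    exact_mod_cast pow_le_card_filter_shiftSet_subset (d := d) (L := L) hR h2R
  have hJ0 : (0 : ℝ) ≤ J.card := Nat.cast_nonneg _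
  have hJle : (J.card : ℝ) ≤ (L : ℝ) ^ d - ((L - 2 * R : ℕ) : ℝ) ^ d := by linarith
  have hce : 0 ≤ c - e := by linarith
  have h3 : (J.card : ℝ) * (c - e) ≤ ((L : ℝ) ^ d - ((L - 2 * R : ℕ) : ℝ) ^ d) * (c - E.groundEnergy) :=
    calc (J.card : ℝ) * (c - e) ≤ ((L : ℝ) ^ d - ((L - 2 * R : ℕ) : ℝ) ^ d) * (c - e) :=
          mul_le_mul_of_nonneg_right hJle hce
      _ ≤ ((L : ℝ) ^ d - ((L - 2 * R : ℕ) : ℝ) ^ d) * (c - E.groundEnergy) :=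
          mul_le_mul_of_nonneg_left (by linarith) (by linarith)
  calc ∑ v ∈ I, T v + ∑ v ∈ J, T v
      ≤ (I.card : ℝ) * e + (J.card : ℝ) * c := by rw [hIsum]; linarith
    _ = (L : ℝ) ^ d * e + (J.card : ℝ) * (c - e) := by rw [← hcardIJ]; ring
    _ ≤ (L : ℝ) ^ d * e + ((L : ℝ) ^ d - ((L - 2 * R : ℕ) : ℝ) ^ d) * (c - E.groundEnergy) := by
        linarith

end BoxState

/-! ### §4 The thermodynamic limit: existence, variational characterisation, attainment -/

/-- A Hermitian matrix has a normalised ground-state vector (`Aψ = E₀ψ`, `‖ψ‖ = 1`): the minimum of the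
Rayleigh quotient is attained. [cite: Tasaki2020, §2.1] -/
theorem exists_unit_groundState_of_isHermitian {n : Type*} [Fintype n] [DecidableEq n] [Nonempty n]
    {A : Matrix n n ℂ} (hA : A.IsHermitian) :
    ∃ ψ : n → ℂ, star ψ ⬝ᵥ ψ = 1 ∧ A *ᵥ ψ = (A.groundEnergy : ℂ) • ψ := by
  obtain ⟨v, hv, hv0⟩ := (Submodule.ne_bot_iff _).1 (groundSpace_ne_bot_holds hA)
  have hpos : 0 < ‖(WithLp.toLp 2 v : EuclideanSpace ℂ n)‖ := by
    rw [norm_pos_iff]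
    intro h
    exact hv0 (by simpa using congrArg WithLp.ofLp h)
  refine ⟨((‖(WithLp.toLp 2 v : EuclideanSpace ℂ n)‖ : ℂ))⁻¹ • v, ?_,
    (A.mem_groundSpace_iff _).1 (A.groundSpace.smul_mem _ hv)⟩
  have h1 : ⟪(WithLp.toLp 2 v : EuclideanSpace ℂ n), WithLp.toLp 2 v⟫_ℂ = star v ⬝ᵥ v := by
    rw [EuclideanSpace.inner_eq_star_dotProduct, dotProduct_comm]
  have hvv : star v ⬝ᵥ v = ((‖(WithLp.toLp 2 v : EuclideanSpace ℂ n)‖ : ℂ)) ^ 2 := by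
    rw [← h1, inner_self_eq_norm_sq_to_K]
    rfl
  rw [star_smul, smul_dotProduct, dotProduct_smul, hvv, smul_eq_mul, smul_eq_mul]
  have hc0 : ((‖(WithLp.toLp 2 v : EuclideanSpace ℂ n)‖ : ℂ)) ≠ 0 := by
    exact_mod_cast hpos.ne'
  simp only [Complex.star_def, map_inv₀, Complex.conj_ofReal]
  field_simp

section Limit

variable {Λ' : Finset (Site d)} {E : FermionOp Λ'}
  {H : (L : ℕ) → Matrix (Finset (Orb (FermionTorus d (L + 1)))) (Finset (Orb (FermionTorus d (L + 1)))) ℂ}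
  {L₀ : ℕ}

/-- **Upper asymptotics**: for every translation-invariant `ω` and `ε > 0`, eventually
`E₀(H_L)/L^d ≤ Re ω(E) + ε` (the box-state bound §3 with `(1 − (1 − 2R/L)^d) → 0`).
[cite: BratteliRobinsonII1997, §6.2.2] -/
theorem eventually_groundEnergy_div_pow_le (hE : E.IsHermitian)
    (hH : ∀ L : ℕ, L₀ ≤ L → ∀ hInj : Set.InjOn (Torus.proj (d := d) (L + 1)) ↑Λ',
      ∑ v : TorusSite d (L + 1),
        relabel (Orb.translate v) (fermionEmbed (PolySite.toTorusEmb (L + 1) hInj) E) = H L)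
    (ω : InfVolFermionState d) (hω : ω.IsTranslationInvariant) {ε : ℝ} (hε : 0 < ε) :
    ∀ᶠ L : ℕ in atTop, (H L).groundEnergy / (((L + 1 : ℕ) : ℝ)) ^ d ≤ (ω.expect Λ' E).re + ε := by
  obtain ⟨R, hR⟩ := exists_forall_abs_apply_le Λ'
  obtain ⟨L₁, hL₁⟩ := exists_forall_le_injOn_proj Λ'
  set C : ℝ := -(-E).groundEnergy - E.groundEnergy with hCdef
  -- the defect ratio `x_L = (L+1-2R)/(L+1) → 1`
  have hx : Tendsto (fun L : ℕ => ((L + 1 - 2 * R : ℕ) : ℝ) / (((L + 1 : ℕ) : ℝ))) atTop (𝓝 1) := by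
    have h2 : Tendsto (fun L : ℕ => (1 : ℝ) - (2 * R : ℝ) / (((L + 1 : ℕ) : ℝ))) atTop (𝓝 (1 - 0)) :=
      tendsto_const_nhds.sub ((tendsto_const_div_atTop_nhds_zero_nat (2 * R : ℝ)).comp (tendsto_add_atTop_nat 1))
    rw [sub_zero] at h2
    refine h2.congr' ?_
    filter_upwards [eventually_ge_atTop (2 * R)] with L hL
    have hL1 : (0 : ℝ) < ((L + 1 : ℕ) : ℝ) := by positivity
    rw [Nat.cast_sub (by omega), eq_div_iff hL1.ne', sub_mul, div_mul_cancel₀ _ hL1.ne', one_mul]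
    push_cast
    ring
  have hC : Tendsto (fun L : ℕ => C * (1 - (((L + 1 - 2 * R : ℕ) : ℝ) / (((L + 1 : ℕ) : ℝ))) ^ d)) atTop (𝓝 0) := by
    have := ((tendsto_const_nhds (x := (1 : ℝ))).sub (hx.pow d)).const_mul C
    simpa using this
  filter_upwards [(tendsto_order.1 hC).2 ε hε, eventually_ge_atTop L₀, eventually_ge_atTop L₁,
    eventually_ge_atTop (2 * R)] with L hLε hL0 hL1 hLR
  have hInj : Set.InjOn (Torus.proj (d := d) (L + 1)) ↑Λ' := hL₁ _ (by omega)
  have hmain := groundEnergy_le_pow_mul_re_expect_add (L := L + 1) hInj hE hR (by omega) (hH L hL0 hInj) ω hω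
  have hpos : (0 : ℝ) < (((L + 1 : ℕ) : ℝ)) ^ d := by positivity
  rw [div_le_iff₀ hpos]
  have hratio : ((L + 1 - 2 * R : ℕ) : ℝ) ^ d =
      ((((L + 1 - 2 * R : ℕ) : ℝ) / (((L + 1 : ℕ) : ℝ))) ^ d) * (((L + 1 : ℕ) : ℝ)) ^ d := by
    rw [div_pow, div_mul_cancel₀ _ hpos.ne']
  have hcast : ((L + 1 : ℕ) : ℝ) = (((L + 1 : ℕ) : ℕ) : ℝ) := rfl
  push_cast at hmain hratio hpos hLε ⊢
  rw [hratio] at hmain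
  nlinarith [hmain, hLε.le, hpos]

/-- **Along ground states the energy per site is the averaged expectation of `E`** (for all large
sides): with unit ground-state vectors `ψ (K+1)` of `H K`,
`Re (torusAvgExpect (K+1) Λ' E (ψ (K+1))) = E₀(H K)/(K+1)^d`. [cite: Tasaki2020, §2.1] -/
theorem re_torusAvgExpect_eq_groundEnergy_div_of_groundState
    (hH : ∀ L : ℕ, L₀ ≤ L → ∀ hInj : Set.InjOn (Torus.proj (d := d) (L + 1)) ↑Λ',
      ∑ v : TorusSite d (L + 1),
        relabel (Orb.translate v) (fermionEmbed (PolySite.toTorusEmb (L + 1) hInj) E) = H L)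
    {ψ : ∀ L, Fock (Orb (FermionTorus d L))}
    (h1 : ∀ K, L₀ ≤ K → star (ψ (K + 1)) ⬝ᵥ ψ (K + 1) = 1)
    (hψ : ∀ K, L₀ ≤ K → H K *ᵥ ψ (K + 1) = ((H K).groundEnergy : ℂ) • ψ (K + 1)) :
    ∀ᶠ K : ℕ in atTop, (torusAvgExpect (K + 1) Λ' E (ψ (K + 1))).re =
      (H K).groundEnergy / (((K + 1 : ℕ) : ℝ)) ^ d := by
  obtain ⟨L₁, hL₁⟩ := exists_forall_le_injOn_proj Λ'
  filter_upwards [eventually_ge_atTop L₀, eventually_ge_atTop L₁] with K hK0 hK1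
  have hInj : Set.InjOn (Torus.proj (d := d) (K + 1)) ↑Λ' := hL₁ _ (by omega)
  rw [torusAvgExpect_eq, re_torusAvgExpectAt_eq_groundEnergy_div E (K + 1) hInj (hH K hK0 hInj) (h1 K hK0) (hψ K hK0)]

/-- **Subsequence step**: ground-state vectors `ψ (K+1)` of `H K` (unit, for `K ≥ L₀`) and a strictly
increasing `Ks` with `L₀ ≤ Ks j`: some sub-subsequence has a translation-invariant torus limit `ω`, and
the energies per site converge to `Re ω(E)` along it (weak-⋆ compactness).
[cite: BratteliRobinsonI1987, Thm. 2.3.15 and §4.3.1] -/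
theorem exists_subseq_tendsto_groundEnergy_div_pow
    (hH : ∀ L : ℕ, L₀ ≤ L → ∀ hInj : Set.InjOn (Torus.proj (d := d) (L + 1)) ↑Λ',
      ∑ v : TorusSite d (L + 1),
        relabel (Orb.translate v) (fermionEmbed (PolySite.toTorusEmb (L + 1) hInj) E) = H L)
    {ψ : ∀ L, Fock (Orb (FermionTorus d L))}
    (h1 : ∀ K, L₀ ≤ K → star (ψ (K + 1)) ⬝ᵥ ψ (K + 1) = 1)
    (hψ : ∀ K, L₀ ≤ K → H K *ᵥ ψ (K + 1) = ((H K).groundEnergy : ℂ) • ψ (K + 1))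
    {Ks : ℕ → ℕ} (hKs : StrictMono Ks) (hKs0 : ∀ j, L₀ ≤ Ks j) :
    ∃ φ : ℕ → ℕ, StrictMono φ ∧ ∃ ω : InfVolFermionState d, ω.IsTranslationInvariant ∧
      ω.IsTorusLimitOf ψ (fun j => Ks (φ j) + 1) ∧
      Tendsto (fun j => (H (Ks (φ j))).groundEnergy / (((Ks (φ j) + 1 : ℕ) : ℝ)) ^ d) atTop
        (𝓝 (ω.expect Λ' E).re) := by
  have hLs : Tendsto (fun j => Ks j + 1) atTop atTop := (tendsto_add_atTop_nat 1).comp hKs.tendsto_atTop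
  obtain ⟨φ, hφ, ω, hω⟩ := InfVolFermionState.exists_isTorusLimitOf_subseq ψ (Ls := fun j => Ks j + 1)
    hLs (fun j => h1 _ (hKs0 j))
  refine ⟨φ, hφ, ω, hω.isTranslationInvariant, hω, ?_⟩
  have hlim := (Complex.continuous_re.tendsto _).comp (hω Λ' E)
  have hKφ : Tendsto (fun j => Ks (φ j)) atTop atTop := hKs.tendsto_atTop.comp hφ.tendsto_atTop
  have hev := (re_torusAvgExpect_eq_groundEnergy_div_of_groundState hH h1 hψ)
  have hev' := hKφ.eventually hev
  refine hlim.congr' ?_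
  filter_upwards [hev'] with j hj
  rw [Function.comp_apply]
  exact hj

/-- **THE THERMODYNAMIC LIMIT of the ground-state energy density of a periodised local Hamiltonian.**
For Hermitian `E ∈ 𝔄_{Λ'}` and the family `H L = Σ_v T_v Γ(E) T_v⁻¹` on the tori of side `L + 1 ≥ L₀ + 1`:
`E₀(H L)/(L+1)^d` CONVERGES, its limit `e_∞` satisfies `e_∞ ≤ Re ω(E)` for every translation-invariant
infinite-volume state `ω`, and `e_∞ = Re ω⋆(E)` for some translation-invariant `ω⋆` — i.e.
`e_∞ = min {Re ω(E) : ω translation invariant}` (Bratteli–Kishimoto–Robinson's mean-energy minimum,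
realised by periodic boundary conditions). Upper half: the box state (§3); lower half and attainment:
weak-⋆ compactness of translation-averaged ground states along subsequences.
[cite: BratteliKishimotoRobinson1978, Thm. 2] -/
theorem exists_tendsto_groundEnergy_div_pow (hE : E.IsHermitian)
    (hH : ∀ L : ℕ, L₀ ≤ L → ∀ hInj : Set.InjOn (Torus.proj (d := d) (L + 1)) ↑Λ',
      ∑ v : TorusSite d (L + 1),
        relabel (Orb.translate v) (fermionEmbed (PolySite.toTorusEmb (L + 1) hInj) E) = H L) :
    ∃ e : ℝ, Tendsto (fun L : ℕ => (H L).groundEnergy / (((L + 1 : ℕ) : ℝ)) ^ d) atTop (𝓝 e) ∧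
      (∀ ω : InfVolFermionState d, ω.IsTranslationInvariant → e ≤ (ω.expect Λ' E).re) ∧
      ∃ ω : InfVolFermionState d, ω.IsTranslationInvariant ∧ (ω.expect Λ' E).re = e := by
  classical
  -- the candidate: the infimum of the mean energies of translation-invariant states
  set S : Set ℝ := {x | ∃ ω : InfVolFermionState d, ω.IsTranslationInvariant ∧ (ω.expect Λ' E).re = x}
    with hS
  have hSne : S.Nonempty := ⟨_, vacuumState d, InfVolFermionState.vacuumState_isTranslationInvariant, rfl⟩
  have hSbdd : BddBelow S := by
    refine ⟨E.groundEnergy, ?_⟩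
    rintro x ⟨ω, -, rfl⟩
    exact ω.groundEnergy_le_re_expect Λ' hE
  set s := sInf S with hs
  have hsle : ∀ ω : InfVolFermionState d, ω.IsTranslationInvariant → s ≤ (ω.expect Λ' E).re :=
    fun ω hω => csInf_le hSbdd ⟨ω, hω, rfl⟩
  -- ground-state vectors for every side
  haveI : ∀ K : ℕ, Nonempty (Finset (Orb (FermionTorus d (K + 1)))) := fun K => ⟨∅⟩
  obtain ⟨L₁, hL₁⟩ := exists_forall_le_injOn_proj Λ'
  set M := max L₀ L₁ with hM
  have hHerm : ∀ K, M ≤ K → (H K).IsHermitian := by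
    intro K hK
    have hInj : Set.InjOn (Torus.proj (d := d) (K + 1)) ↑Λ' := hL₁ _ (by omega)
    rw [← hH K (by omega) hInj]
    exact isHermitian_sum_relabel_translate E (K + 1) hInj hE
  have hgs : ∀ K, ∃ ψ : Fock (Orb (FermionTorus d (K + 1))), M ≤ K →
      star ψ ⬝ᵥ ψ = 1 ∧ H K *ᵥ ψ = ((H K).groundEnergy : ℂ) • ψ := by
    intro K
    by_cases hK : M ≤ K
    · obtain ⟨ψ, h1, h2⟩ := exists_unit_groundState_of_isHermitian (hHerm K hK)
      exact ⟨ψ, fun _ => ⟨h1, h2⟩⟩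
    · exact ⟨0, fun h => (hK h).elim⟩
  choose ψ' hψ' using hgs
  set ψ : ∀ L, Fock (Orb (FermionTorus d L)) := fun L => Nat.rec 0 (fun K _ => ψ' K) L with hψdef
  have hψsucc : ∀ K, ψ (K + 1) = ψ' K := fun K => rfl
  have h1 : ∀ K, M ≤ K → star (ψ (K + 1)) ⬝ᵥ ψ (K + 1) = 1 := fun K hK => by
    rw [hψsucc]; exact (hψ' K hK).1
  have hψgs : ∀ K, M ≤ K → H K *ᵥ ψ (K + 1) = ((H K).groundEnergy : ℂ) • ψ (K + 1) := fun K hK => by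
    rw [hψsucc]; exact (hψ' K hK).2
  have hH' : ∀ L : ℕ, M ≤ L → ∀ hInj : Set.InjOn (Torus.proj (d := d) (L + 1)) ↑Λ',
      ∑ v : TorusSite d (L + 1),
        relabel (Orb.translate v) (fermionEmbed (PolySite.toTorusEmb (L + 1) hInj) E) = H L :=
    fun L hL hInj => hH L (by omega) hInj
  set b : ℕ → ℝ := fun L => (H L).groundEnergy / (((L + 1 : ℕ) : ℝ)) ^ d with hb
  -- upper: eventually `b L < t` for every `t > s`
  have hupper : ∀ t, s < t → ∀ᶠ L in atTop, b L < t := by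
    intro t ht
    obtain ⟨x, ⟨ω, hω, rfl⟩, hx⟩ := exists_lt_of_csInf_lt hSne (show s < (s + t) / 2 by linarith)
    have hε : 0 < (t - s) / 2 := by linarith
    filter_upwards [eventually_groundEnergy_div_pow_le hE hH ω hω hε] with L hL
    simp only [hb]
    linarith
  -- lower: eventually `t < b L` for every `t < s` (else a subsequence of ground states has a
  -- translation-invariant limit with mean energy `≤ t < s`)
  have hlower : ∀ t, t < s → ∀ᶠ L in atTop, t < b L := by
    intro t ht
    by_contra hcon
    have hfreq : ∃ᶠ L in atTop, b L ≤ t ∧ M ≤ L := by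
      have h' : ∃ᶠ L in atTop, b L ≤ t := by
        rw [Filter.not_eventually] at hcon
        exact hcon.mono fun L hL => not_lt.1 hL
      exact h'.and_eventually (eventually_ge_atTop M)
    obtain ⟨Ks, hKs, hKsP⟩ := Filter.extraction_of_frequently_atTop hfreq
    obtain ⟨φ, hφ, ω, hωTI, -, hlim⟩ := exists_subseq_tendsto_groundEnergy_div_pow hH' h1 hψgs hKs
      (fun j => (hKsP j).2)
    have hle : (ω.expect Λ' E).re ≤ t := le_of_tendsto' hlim fun j => (hKsP (φ j)).1
    exact absurd ((hsle ω hωTI).trans hle) (not_le.2 ht)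
  have hconv : Tendsto b atTop (𝓝 s) := tendsto_order.2 ⟨hlower, hupper⟩
  -- attainment: the full sequence of ground states has a subsequence with a limit state
  obtain ⟨φ, hφ, ω, hωTI, -, hlim⟩ := exists_subseq_tendsto_groundEnergy_div_pow hH' h1 hψgs
    (Ks := fun j => j + M) (fun a b hab => by simpa using hab) (fun j => by omega)
  have hlim' : Tendsto (fun j => b (φ j + M)) atTop (𝓝 s) :=
    hconv.comp ((tendsto_add_atTop_nat M).comp hφ.tendsto_atTop)
  exact ⟨s, hconv, hsle, ω, hωTI, tendsto_nhds_unique hlim hlim'⟩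

end Limit

end Literature.MathematicalPhysics.QuantumLattice

end
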